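import Summits.AnomalousDissipation.AnomalousDissipation.Theses.TaylorCertificates
import Summits.AnomalousDissipation.AnomalousDissipation.Theorems.TaylorCertificatePair.Negative.Bounds

/-!
# `KolmogorovFloor` (stmt-AnomalousDissipation-14030), negative side: the state of rest and the dual reading

cdisprove seat `refuter-cdisprove-stmt-AnomalousDissipation-14030-0` (2026-08-16). Kernel-checked NECESSARY
CONDITIONS on the inner block of the crux (a cylindrical `Φ₁` and a weight `θ₁ ≤ 0` certifying the floor `ε₀`
at viscosity `ν` on the finite-enstrophy part of the Leray ball; the resolution plays no role here), written over
the tree's objects only (no new definitions):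

* `rest_terms`, `rest_injects` — at rest every term of the floor functional but the injection `(f, Φ₁'(0))`
  vanishes, so the multiplier at rest injects at least `ε₀`; for a witness of the crux:
  `kolmogorovFloor_injects_at_rest`, `kolmogorovFloor_force_ne_zero` (`f = 0`, `Φ₁.m = 0`, `N = 0` are no witnesses).
* `steady_state_loud`, `kolmogorovFloor_steady_states_loud` — THE DUAL READING: every steady weak
  Navier–Stokes state `u ∈ H` (`Torus.IsSteadyWeakSolution ν f u`) with finite enstrophy, in the Leray ball
  and with non-negative energy defect `(u,f) − ν‖∇u‖² ≥ 0` is LOUD: `ν‖∇u‖² ≥ ε₀`. Quiet steady states of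
  `NS_ν(f)` at arbitrarily small `ν` refute every pointwise floor for `f`, whatever the resolution.
-/

noncomputable section

open MeasureTheory UnitAddTorus Matrix
open scoped InnerProductSpace ENNReal ComplexConjugate

namespace Summit.AnomalousDissipation.AnomalousDissipation.Theorems.KolmogorovFloor.Negative

open Literature.Analysis.FunctionSpaces Literature.Analysis.FluidPDE
open Summit.AnomalousDissipation.AnomalousDissipation.Theorems.TaylorCertificatePair.Negative

/-! ### At rest: the multiplier must inject; the dual reading -/

/-- At rest (`u = 0 ∈ H`) the dissipation, the drift, the inertial term and the energy channel vanish: the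
floor functional reduces to the injection `(f, W)` through the multiplier field `W`. -/
theorem rest_terms (f : (UnitAddTorus (Fin 3)) → (EuclideanSpace ℝ (Fin 3))) (ν θ : ℝ) (W : (UnitAddTorus (Fin 3)) → (EuclideanSpace ℝ (Fin 3))) :
    ν * (Torus.eGradNormSq (((0 : (Torus.energySpace (Fin 3))) : (Lp (EuclideanSpace ℝ (Fin 3)) 2 (volume : Measure (UnitAddTorus (Fin 3))))) : (UnitAddTorus (Fin 3)) → (EuclideanSpace ℝ (Fin 3)))).toReal + Torus.nsGeneratorPairing ν f (0 : (Torus.energySpace (Fin 3))) W +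
      2 * θ * (Torus.pairing ((0 : (Torus.energySpace (Fin 3))) : (Lp (EuclideanSpace ℝ (Fin 3)) 2 (volume : Measure (UnitAddTorus (Fin 3))))) f - ν * (Torus.eGradNormSq (((0 : (Torus.energySpace (Fin 3))) : (Lp (EuclideanSpace ℝ (Fin 3)) 2 (volume : Measure (UnitAddTorus (Fin 3))))) : (UnitAddTorus (Fin 3)) → (EuclideanSpace ℝ (Fin 3)))).toReal) = ∫ x, ⟪f x, W x⟫_ℝ := by
  have h2 : (∫ x, ⟪(((0 : (Torus.energySpace (Fin 3))) : (Lp (EuclideanSpace ℝ (Fin 3)) 2 (volume : Measure (UnitAddTorus (Fin 3))))) : (UnitAddTorus (Fin 3)) → (EuclideanSpace ℝ (Fin 3))) x, Torus.laplacian W x⟫_ℝ) = 0 := by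
    rw [← integral_zero (α := (UnitAddTorus (Fin 3))) (G := ℝ)]
    refine integral_congr_ae ?_
    filter_upwards [coe_zero_ae] with x hx
    rw [hx]
    simp
  have h3 : (∫ x, ⟪Torus.fderiv W x ((((0 : (Torus.energySpace (Fin 3))) : (Lp (EuclideanSpace ℝ (Fin 3)) 2 (volume : Measure (UnitAddTorus (Fin 3))))) : (UnitAddTorus (Fin 3)) → (EuclideanSpace ℝ (Fin 3))) x), (((0 : (Torus.energySpace (Fin 3))) : (Lp (EuclideanSpace ℝ (Fin 3)) 2 (volume : Measure (UnitAddTorus (Fin 3))))) : (UnitAddTorus (Fin 3)) → (EuclideanSpace ℝ (Fin 3))) x⟫_ℝ) = 0 := by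
    rw [← integral_zero (α := (UnitAddTorus (Fin 3))) (G := ℝ)]
    refine integral_congr_ae ?_
    filter_upwards [coe_zero_ae] with x hx
    rw [hx]
    simp
  have h4 : Torus.pairing ((0 : (Torus.energySpace (Fin 3))) : (Lp (EuclideanSpace ℝ (Fin 3)) 2 (volume : Measure (UnitAddTorus (Fin 3))))) f = 0 := by
    unfold Torus.pairing
    rw [← integral_zero (α := (UnitAddTorus (Fin 3))) (G := ℝ)]
    refine integral_congr_ae ?_
    filter_upwards [coe_zero_ae] with x hx
    rw [hx]
    simp
  unfold Torus.nsGeneratorPairing Torus.inertialPairing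
  rw [h2, h3, h4, eGradNormSq_coe_zero]
  simp

/-- **The multiplier at rest injects.** If `(Φ₁, θ₁)` certify the floor `ε₀` at viscosity `ν` on the
finite-enstrophy part of the Leray ball (the inner block of the crux, at any resolution), then
`ε₀ ≤ (f, Φ₁'(0))` — test the floor at `u = 0`. -/
theorem rest_injects {ν : ℝ} {f : (UnitAddTorus (Fin 3)) → (EuclideanSpace ℝ (Fin 3))} {ε₀ θ₁ : ℝ}
    {Φ₁ : Torus.CylindricalTest (Fin 3)} (hν : 0 < ν)
    (hu : ∀ u : Literature.Analysis.FunctionSpaces.Torus.energySpace (Fin 3), let uf : UnitAddTorus (Fin 3) → EuclideanSpace ℝ (Fin 3) := ((u : MeasureTheory.Lp (EuclideanSpace ℝ (Fin 3)) 2 (MeasureTheory.volume : MeasureTheory.Measure (UnitAddTorus (Fin 3)))) : UnitAddTorus (Fin 3) → EuclideanSpace ℝ (Fin 3)); let D : ℝ := ν * (Literature.Analysis.FunctionSpaces.Torus.eGradNormSq uf).toReal; let P : ℝ := Literature.Analysis.FluidPDE.Torus.pairing (u : MeasureTheory.Lp (EuclideanSpace ℝ (Fin 3)) 2 (MeasureTheory.volume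 : MeasureTheory.Measure (UnitAddTorus (Fin 3)))) f - D; Literature.Analysis.FunctionSpaces.Torus.eGradNormSq uf ≠ ⊤ → ‖u‖ ^ 2 ≤ 16 * (∫ x, ‖f x‖ ^ 2) / ν ^ 2 → ε₀ ≤ D + Literature.Analysis.FluidPDE.Torus.nsGeneratorPairing ν f u (Φ₁.grad u) + 2 * θ₁ * P) :
    ε₀ ≤ ∫ x, ⟪f x, Φ₁.grad 0 x⟫_ℝ := by
  have hu0 := hu (0 : (Torus.energySpace (Fin 3)))
  dsimp only at hu0
  have h1 : Torus.eGradNormSq (((0 : (Torus.energySpace (Fin 3))) : (Lp (EuclideanSpace ℝ (Fin 3)) 2 (volume : Measure (UnitAddTorus (Fin 3))))) : (UnitAddTorus (Fin 3)) → (EuclideanSpace ℝ (Fin 3))) ≠ ⊤ := by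
    rw [eGradNormSq_coe_zero]; exact ENNReal.zero_ne_top
  have h2 : ‖(0 : (Torus.energySpace (Fin 3)))‖ ^ 2 ≤ 16 * (∫ x, ‖f x‖ ^ 2) / ν ^ 2 := by
    rw [norm_zero]
    have : 0 ≤ ∫ x, ‖f x‖ ^ 2 := integral_nonneg fun x => by positivity
    have h16 : 0 ≤ 16 * (∫ x, ‖f x‖ ^ 2) / ν ^ 2 := by positivity
    simpa using h16
  have hfl := hu0 h1 h2
  rwa [rest_terms] at hfl

/-- **The dual reading: steady states are loud.** If `(Φ₁, θ₁)`, `θ₁ ≤ 0`, certify the floor `ε₀` at viscosity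
`ν` (inner block of the crux, any resolution), then every steady weak Navier–Stokes state `u ∈ H`
(`Torus.IsSteadyWeakSolution ν f u`: `⟨F_ν(u), w⟩ = 0` for all `w ∈ 𝒱`) with finite enstrophy, in the Leray
ball and with non-negative energy defect `(u, f) − ν‖∇u‖² ≥ 0` (equality for `u ∈ V`, `d ≤ 4`; the inequality is
what weak limits give) dissipates at least `ε₀`. Proof: the generator term vanishes at `w = Φ₁'(u) ∈ 𝒱`, the
energy channel has the sign of `θ₁`. So a quiet steady state in the ball refutes every pointwise floor. -/
theorem steady_state_loud {ν : ℝ} {f : (UnitAddTorus (Fin 3)) → (EuclideanSpace ℝ (Fin 3))} {ε₀ θ₁ : ℝ}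
    {Φ₁ : Torus.CylindricalTest (Fin 3)} (hθ₁ : θ₁ ≤ 0)
    (hu : ∀ u : Literature.Analysis.FunctionSpaces.Torus.energySpace (Fin 3), let uf : UnitAddTorus (Fin 3) → EuclideanSpace ℝ (Fin 3) := ((u : MeasureTheory.Lp (EuclideanSpace ℝ (Fin 3)) 2 (MeasureTheory.volume : MeasureTheory.Measure (UnitAddTorus (Fin 3)))) : UnitAddTorus (Fin 3) → EuclideanSpace ℝ (Fin 3)); let D : ℝ := ν * (Literature.Analysis.FunctionSpaces.Torus.eGradNormSq uf).toReal; let P : ℝ := Literature.Analysis.FluidPDE.Torus.pairing (u : MeasureTheory.Lp (EuclideanSpace ℝ (Fin 3)) 2 (MeasureTheory.volume : MeasureTheory.Measure (UnitAddTorus (Fin 3)))) f - D; Literature.Analysis.FunctionSpaces.Torus.eGradNormSq uf ≠ ⊤ → ‖u‖ ^ 2 ≤ 16 * (∫ x, ‖f x‖ ^ 2) / ν ^ 2 → ε₀ ≤ D + Literature.Analysis.FluidPDE.Torus.nsGeneratorPairing ν f u (Φ₁.grad u) + 2 * θ₁ * P)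
    (u : Torus.energySpace (Fin 3))
    (hfin : Torus.eGradNormSq (((u : (Torus.energySpace (Fin 3))) : (Lp (EuclideanSpace ℝ (Fin 3)) 2 (volume : Measure (UnitAddTorus (Fin 3))))) : (UnitAddTorus (Fin 3)) → (EuclideanSpace ℝ (Fin 3))) ≠ ⊤)
    (hball : ‖u‖ ^ 2 ≤ 16 * (∫ x, ‖f x‖ ^ 2) / ν ^ 2)
    (hsteady : Torus.IsSteadyWeakSolution ν f u)
    (hdefect : ν * (Torus.eGradNormSq (((u : (Torus.energySpace (Fin 3))) : (Lp (EuclideanSpace ℝ (Fin 3)) 2 (volume : Measure (UnitAddTorus (Fin 3))))) : (UnitAddTorus (Fin 3)) → (EuclideanSpace ℝ (Fin 3)))).toReal ≤ Torus.pairing ((u : (Torus.energySpace (Fin 3))) : (Lp (EuclideanSpace ℝ (Fin 3)) 2 (volume : Measure (UnitAddTorus (Fin 3))))) f) :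
    ε₀ ≤ ν * (Torus.eGradNormSq (((u : (Torus.energySpace (Fin 3))) : (Lp (EuclideanSpace ℝ (Fin 3)) 2 (volume : Measure (UnitAddTorus (Fin 3))))) : (UnitAddTorus (Fin 3)) → (EuclideanSpace ℝ (Fin 3)))).toReal := by
  have hu' := hu u
  dsimp only at hu'
  have hfl := hu' hfin hball
  have hgen : Torus.nsGeneratorPairing ν f u (Φ₁.grad u) = 0 :=
    hsteady _ (isSmooth_grad Φ₁ u) (isDivFree_grad Φ₁ u) (hasZeroMean_grad Φ₁ u)
  rw [hgen, add_zero] at hfl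
  have hP : 0 ≤ Torus.pairing ((u : (Torus.energySpace (Fin 3))) : (Lp (EuclideanSpace ℝ (Fin 3)) 2 (volume : Measure (UnitAddTorus (Fin 3))))) f - ν * (Torus.eGradNormSq (((u : (Torus.energySpace (Fin 3))) : (Lp (EuclideanSpace ℝ (Fin 3)) 2 (volume : Measure (UnitAddTorus (Fin 3))))) : (UnitAddTorus (Fin 3)) → (EuclideanSpace ℝ (Fin 3)))).toReal := by linarith
  have hch : 2 * θ₁ * (Torus.pairing ((u : (Torus.energySpace (Fin 3))) : (Lp (EuclideanSpace ℝ (Fin 3)) 2 (volume : Measure (UnitAddTorus (Fin 3))))) f - ν * (Torus.eGradNormSq (((u : (Torus.energySpace (Fin 3))) : (Lp (EuclideanSpace ℝ (Fin 3)) 2 (volume : Measure (UnitAddTorus (Fin 3))))) : (UnitAddTorus (Fin 3)) → (EuclideanSpace ℝ (Fin 3)))).toReal) ≤ 0 := by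
    nlinarith
  linarith

/-! ### Corollaries in the shape of the crux (`β = 3/4`): what every witness of `KolmogorovFloor` must satisfy -/

/-- For a witness `(f, ε₀, C, Θ, ν₀)` of `KolmogorovFloor` (its inner block `hall`): at every `ν ∈ (0, ν₀)` the
multiplier at rest injects, `ε₀ ≤ (f, Φ₁'(0))`. -/
theorem kolmogorovFloor_injects_at_rest
    {f : (UnitAddTorus (Fin 3)) → (EuclideanSpace ℝ (Fin 3))} {ε₀ C Θ ν₀ : ℝ}
    (hall : ∀ ν : ℝ, 0 < ν → ν < ν₀ → ∃ (N : ℕ) (Φ₁ : Literature.Analysis.FluidPDE.Torus.CylindricalTest (Fin 3)) (θ₁ : ℝ), (N : ℝ) ≤ C * ν ^ (-(3 / 4 : ℝ)) ∧ (∀ i, Literature.Analysis.FunctionSpaces.Torus.fourierTruncate N (Φ₁.g i) = Φ₁.g i) ∧ -Θ ≤ θ₁ ∧ θ₁ ≤ 0 ∧ ∀ u : Literature.Analysis.FunctionSpaces.Torus.energySpace (Fin 3), let uf : UnitAddTorus (Fin 3) → EuclideanSpace ℝ (Fin 3) := ((u : MeasureTheory.Lp (EuclideanSpace ℝ (Fin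 3)) 2 (MeasureTheory.volume : MeasureTheory.Measure (UnitAddTorus (Fin 3)))) : UnitAddTorus (Fin 3) → EuclideanSpace ℝ (Fin 3)); let D : ℝ := ν * (Literature.Analysis.FunctionSpaces.Torus.eGradNormSq uf).toReal; let P : ℝ := Literature.Analysis.FluidPDE.Torus.pairing (u : MeasureTheory.Lp (EuclideanSpace ℝ (Fin 3)) 2 (MeasureTheory.volume : MeasureTheory.Measure (UnitAddTorus (Fin 3)))) f - D; Literature.Analysis.FunctionSpaces.Torus.eGradNormSq uf ≠ ⊤ → ‖u‖ ^ 2 ≤ 16 * (∫ x, ‖f x‖ ^ 2) / ν ^ 2 → ε₀ ≤ D + Literature.Analysis.FluidPDE.Torus.nsGeneratorPairing ν f u (Φ₁.grad u) + 2 * θ₁ * P)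
    {ν : ℝ} (hν : 0 < ν) (hνν₀ : ν < ν₀) :
    ∃ (N : ℕ) (Φ₁ : Torus.CylindricalTest (Fin 3)), (N : ℝ) ≤ C * ν ^ (-(3 / 4 : ℝ)) ∧
      (∀ i, Torus.fourierTruncate N (Φ₁.g i) = Φ₁.g i) ∧ ε₀ ≤ ∫ x, ⟪f x, Φ₁.grad 0 x⟫_ℝ := by
  obtain ⟨N, Φ₁, θ₁, hN, hband, -, -, hu⟩ := hall ν hν hνν₀
  exact ⟨N, Φ₁, hN, hband, rest_injects hν hu⟩

/-- For a witness of `KolmogorovFloor` the force is not a.e. zero: `0 < ‖f‖₂²`. -/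
theorem kolmogorovFloor_force_ne_zero
    {f : (UnitAddTorus (Fin 3)) → (EuclideanSpace ℝ (Fin 3))} (hf : Torus.IsSmooth f) {ε₀ C Θ ν₀ : ℝ} (hε₀ : 0 < ε₀) (hν₀ : 0 < ν₀)
    (hall : ∀ ν : ℝ, 0 < ν → ν < ν₀ → ∃ (N : ℕ) (Φ₁ : Literature.Analysis.FluidPDE.Torus.CylindricalTest (Fin 3)) (θ₁ : ℝ), (N : ℝ) ≤ C * ν ^ (-(3 / 4 : ℝ)) ∧ (∀ i, Literature.Analysis.FunctionSpaces.Torus.fourierTruncate N (Φ₁.g i) = Φ₁.g i) ∧ -Θ ≤ θ₁ ∧ θ₁ ≤ 0 ∧ ∀ u : Literature.Analysis.FunctionSpaces.Torus.energySpace (Fin 3), let uf : UnitAddTorus (Fin 3) → EuclideanSpace ℝ (Fin 3) := ((u : MeasureTheory.Lp (EuclideanSpace ℝ (Fin 3)) 2 (MeasureTheory.volume : MeasureTheory.Measure (UnitAddTorus (Fin 3)))) : UnitAddTorus (Fin 3) → EuclideanSpace ℝ (Fin 3)); let D : ℝ := ν * (Literature.Analysis.FunctionSpaces.Torus.eGradNormSq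 uf).toReal; let P : ℝ := Literature.Analysis.FluidPDE.Torus.pairing (u : MeasureTheory.Lp (EuclideanSpace ℝ (Fin 3)) 2 (MeasureTheory.volume : MeasureTheory.Measure (UnitAddTorus (Fin 3)))) f - D; Literature.Analysis.FunctionSpaces.Torus.eGradNormSq uf ≠ ⊤ → ‖u‖ ^ 2 ≤ 16 * (∫ x, ‖f x‖ ^ 2) / ν ^ 2 → ε₀ ≤ D + Literature.Analysis.FluidPDE.Torus.nsGeneratorPairing ν f u (Φ₁.grad u) + 2 * θ₁ * P) :
    0 < ∫ x, ‖f x‖ ^ 2 := by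
  have hF2nn : 0 ≤ ∫ x, ‖f x‖ ^ 2 := integral_nonneg fun x => by positivity
  refine lt_of_le_of_ne hF2nn fun hF0 => ?_
  obtain ⟨N, Φ₁, -, -, hinj⟩ := kolmogorovFloor_injects_at_rest hall (half_pos hν₀) (half_lt_self hν₀)
  have hae := ae_zero_of_integral_sq_zero hf hF0.symm
  have hzero : (∫ x, ⟪f x, Φ₁.grad 0 x⟫_ℝ) = 0 := by
    rw [← integral_zero (α := (UnitAddTorus (Fin 3))) (G := ℝ)]
    refine integral_congr_ae ?_
    filter_upwards [hae] with x hx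
    simp [hx]
  linarith

/-- **Dual reading of the crux.** For a witness `(f, ε₀, C, Θ, ν₀)` of `KolmogorovFloor`, at every `ν ∈ (0, ν₀)`
every steady weak Navier–Stokes state `u ∈ H` with finite enstrophy, in the Leray ball and with non-negative
energy defect is loud: `ε₀ ≤ ν‖∇u‖²`. Quiet steady states of `NS_ν(f)` at arbitrarily small `ν` would refute the
floor for `f` at ANY resolution. -/
theorem kolmogorovFloor_steady_states_loud
    {f : (UnitAddTorus (Fin 3)) → (EuclideanSpace ℝ (Fin 3))} {ε₀ C Θ ν₀ : ℝ}
    (hall : ∀ ν : ℝ, 0 < ν → ν < ν₀ → ∃ (N : ℕ) (Φ₁ : Literature.Analysis.FluidPDE.Torus.CylindricalTest (Fin 3)) (θ₁ : ℝ), (N : ℝ) ≤ C * ν ^ (-(3 / 4 : ℝ)) ∧ (∀ i, Literature.Analysis.FunctionSpaces.Torus.fourierTruncate N (Φ₁.g i) = Φ₁.g i) ∧ -Θ ≤ θ₁ ∧ θ₁ ≤ 0 ∧ ∀ u : Literature.Analysis.FunctionSpaces.Torus.energySpace (Fin 3), let uf : UnitAddTorus (Fin 3) → EuclideanSpace ℝ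 (Fin 3) := ((u : MeasureTheory.Lp (EuclideanSpace ℝ (Fin 3)) 2 (MeasureTheory.volume : MeasureTheory.Measure (UnitAddTorus (Fin 3)))) : UnitAddTorus (Fin 3) → EuclideanSpace ℝ (Fin 3)); let D : ℝ := ν * (Literature.Analysis.FunctionSpaces.Torus.eGradNormSq uf).toReal; let P : ℝ := Literature.Analysis.FluidPDE.Torus.pairing (u : MeasureTheory.Lp (EuclideanSpace ℝ (Fin 3)) 2 (MeasureTheory.volume : MeasureTheory.Measure (UnitAddTorus (Fin 3)))) f - D; Literature.Analysis.FunctionSpaces.Torus.eGradNormSq uf ≠ ⊤ → ‖u‖ ^ 2 ≤ 16 * (∫ x, ‖f x‖ ^ 2) / ν ^ 2 → ε₀ ≤ D + Literature.Analysis.FluidPDE.Torus.nsGeneratorPairing ν f u (Φ₁.grad u) + 2 * θ₁ * P)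
    {ν : ℝ} (hν : 0 < ν) (hνν₀ : ν < ν₀)
    (u : Torus.energySpace (Fin 3))
    (hfin : Torus.eGradNormSq (((u : (Torus.energySpace (Fin 3))) : (Lp (EuclideanSpace ℝ (Fin 3)) 2 (volume : Measure (UnitAddTorus (Fin 3))))) : (UnitAddTorus (Fin 3)) → (EuclideanSpace ℝ (Fin 3))) ≠ ⊤)
    (hball : ‖u‖ ^ 2 ≤ 16 * (∫ x, ‖f x‖ ^ 2) / ν ^ 2)
    (hsteady : Torus.IsSteadyWeakSolution ν f u)
    (hdefect : ν * (Torus.eGradNormSq (((u : (Torus.energySpace (Fin 3))) : (Lp (EuclideanSpace ℝ (Fin 3)) 2 (volume : Measure (UnitAddTorus (Fin 3))))) : (UnitAddTorus (Fin 3)) → (EuclideanSpace ℝ (Fin 3)))).toReal ≤ Torus.pairing ((u : (Torus.energySpace (Fin 3))) : (Lp (EuclideanSpace ℝ (Fin 3)) 2 (volume : Measure (UnitAddTorus (Fin 3))))) f) :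
    ε₀ ≤ ν * (Torus.eGradNormSq (((u : (Torus.energySpace (Fin 3))) : (Lp (EuclideanSpace ℝ (Fin 3)) 2 (volume : Measure (UnitAddTorus (Fin 3))))) : (UnitAddTorus (Fin 3)) → (EuclideanSpace ℝ (Fin 3)))).toReal := by
  obtain ⟨N, Φ₁, θ₁, -, -, -, hθ₁, hu⟩ := hall ν hν hνν₀
  exact steady_state_loud hθ₁ hu u hfin hball hsteady hdefect

end Summit.AnomalousDissipation.AnomalousDissipation.Theorems.KolmogorovFloor.Negative
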